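import Summits.QuantumFields.QCD.Theses.CounterexampleMustBeHot
import HarnessLib.Audit

/-!
# Skeleton `pieces` for crux `ChiralContinuumComplement` (item stmt-QuantumFields-17304) — `Lines/pieces.lean`

Route `route-QuantumFields-CounterexampleMustBeHot` (sub-problem QCD), crux decl
`Summit.QuantumFields.QCD.Theses.CounterexampleMustBeHot.ChiralContinuumComplement` (re-audit bin RESTATED: the
implication "CHIRAL lattice half ⇒ `QCD`" is a bridge `T → S` whose `T` the thermodynamic chain supplies).
crux-strategist `cstrat-stmt-QuantumFields-17304-r1` (planner), 2026-08-17 — THE TYPED DECOMPOSITION (BC2 redirect),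
registered as a skeleton because `route edit --split` is refused on a non-final cycle: all three stubs are FILED
ITEMS OF THE ROUTE taken BY NAME (the gate closes them with their items), and the composition
`ChiralContinuumComplement_of` is the PROVED assembly (its `Theorems/` twin, with the pieces expanded, is attached as
evidence on stmt-QuantumFields-17304 for a prover to land: `CounterexampleMustBeHotChiralContinuumComplementSplit.lean`).

* `stub_chiralCalibratedConvergence : ChiralCalibratedConvergence` — **piece 1, THE NEW ∀-LAW (item
  stmt-QuantumFields-18044, crux rank 5 of this route): the chiral subsequence of the GIVEN lattice sequence converges
  after calibration.**  For `N_f ∈ {2,3}` and EVERY `reg` carrying the chiral lattice half (the antecedent of the crux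
  verbatim: `HasMassScaling`, `IsChiralAtZero`, asymptotic scaling, branch + uniform lattice gap at every positive
  tuple) there are `φ` strictly increasing and `reg₁` REINDEXED FROM `reg` ALONG `φ` (`a, β, m_crit, Z_m` composed with
  `φ`, volumes only enlarged `L (φ k) ≤ L₁ k`) which is again `IsChiralAtZero` and carries ONE
  `𝒞 : CalibratedSpeciesFamily reg₁` whose calibration bites (glue, `pseudoRe f g` for `f ≠ g`), with a glue
  `κ₃`-witness, and full convergence of every calibrated lattice `n`-point function along the reindexed sequence on
  off-diagonal tensors, at every positive tuple — hypotheses 5–8 of piece 2 at `(reg₁, 𝒞, m)`.  Open / XL (UV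
  stability with light Wilson quarks; its own line is `Lines/chiral_calibrated_convergence.lean`).
* `stub_convergentOSClosure : ConvergentOSClosure` — **piece 2, OS CLOSURE OF A CONVERGENT CALIBRATED FAMILY MODULO
  ROTATIONS** (item stmt-QuantumFields-11525 = `GapBuysCauchyRate.ConvergentOSClosure`, BY NAME; registered skeleton
  `Cruxes/ConvergentOSClosure/Lines/birth.lean`; open / XL).
* `stub_rotationRestoration : RotationRestoration` — **piece 3, THE E1 MODULE** (item stmt-QuantumFields-8840, shared
  with FourMirrorsWardE1 / DiagonalSpine / GapBuysCauchyRate, BY NAME; registered skeletons `Cruxes/RotationRestoration/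
  Lines/{birth,sigma_five_amnesia}.lean`; open).

`ChiralContinuumComplement_of : ChiralCalibratedConvergence → ConvergentOSClosure → RotationRestoration →
ChiralContinuumComplement` is kernel-checked (no `sorry`, axioms propext / Classical.choice / Quot.sound) and is not a
one-line seam (≈ 45 tactic lines): given the chiral lattice half, piece 1 extracts `(φ, reg₁, 𝒞)`; `HasMassScaling` of
`reg₁`, and asymptotic scaling / physical branch / lattice gap of `𝒞.scheme m` are TRANSPORTED from `reg` along `φ`
(tail properties composed with `StrictMono.tendsto_atTop`; the gap also survives the volume enlargement because it
quantifies over all tori `S ≥ L_k`); piece 2 closes the limit family `S` with both gaps at one `Δ`; piece 3 makes `S`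
rotation invariant; piece 2's packaging clause yields `T : OSData` with `T.schwinger = S` and the three non-triviality
clauses; `(reg₁, 𝒞.z m, 𝒞.shift m, T)` witnesses `QCDOf N_f` (`𝒞.scheme m = reg₁.scheme m (𝒞.z m) (𝒞.shift m)` by
`rfl`), chirality handed over from piece 1; `N_f = 2, 3`.  Load-bearing: all three (drop piece 1: no convergent data;
drop piece 2: no axioms / continuum gap / packaging; drop piece 3: no E1, and piece 2's packaging needs it).

Per-piece probes (strategist folder `bc/probe_<Piece>_{QCD,CCoC}.lean`, 6 files × 5 examples — probe 0 the prescribed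
`first | exact? | simpa [P] | (unfold P; simpa) | aesop`, probes 1–4 each arm alone, `maxHeartbeats 400000`): ALL 30
FAIL (whnf time-outs / `exact?` could not close the goal / `simpa` time-out or `assumption` failed / aesop exhaustive
search failed): no piece gives the crux or `QCD` on its own.
-/

noncomputable section

namespace Summit.QuantumFields.QCD.Cruxes.ChiralContinuumComplement.Pieces

open Filter Topology
open Summit.QuantumFields.QCD.Theses.CounterexampleMustBeHot

/-! ## §1 The registered stubs (the ONLY `sorry`s of this file) — all three are route items BY NAME -/

/-- piece 1 (item stmt-QuantumFields-18044, crux of this route): the chiral subsequence of the given sequence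
converges after calibration — open / XL. -/
theorem stub_chiralCalibratedConvergence : ChiralCalibratedConvergence := by
  sorry

/-- piece 2 (item stmt-QuantumFields-11525, `GapBuysCauchyRate.ConvergentOSClosure` by name): OS closure of a
convergent calibrated family modulo rotations — open / XL. -/
theorem stub_convergentOSClosure : ConvergentOSClosure := by
  sorry

/-- piece 3 (item stmt-QuantumFields-8840, by name): rotation restoration (E1) — open. -/
theorem stub_rotationRestoration : RotationRestoration := by
  sorry

/-! ## §2 The composition (sorry-free): the ASSEMBLY of the decomposition -/

/-- **`ChiralContinuumComplement` from its three pieces.** -/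
theorem ChiralContinuumComplement_of :
    ChiralCalibratedConvergence → ConvergentOSClosure → RotationRestoration → ChiralContinuumComplement := by
  intro h₁ h₂ h₃

  intro hCLH
  have key : ∀ Nf : ℕ, Nf = 2 ∨ Nf = 3 → QCDOf Nf := by
    intro Nf hNf
    obtain ⟨reg, hms, hchi, has, H⟩ := hCLH Nf hNf
    obtain ⟨φ, reg₁, hφ, ha, hβ, hmc, hZm, hL, hchi₁, 𝒞, H₁⟩ := h₁ Nf hNf reg hms hchi has H
    -- (i) leading-log mass scaling rides along the subsequence (reads `a`, `Z_m` only)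
    have hms₁ : reg₁.HasMassScaling := by
      obtain ⟨c, hc, ht⟩ := hms
      refine ⟨c, hc, ?_⟩
      have hfun : (fun k => reg₁.Zm k / Real.log (1 / reg₁.a k ^ 2) ^
          Literature.MathematicalPhysics.QuantumFieldTheory.massExponent Nf) =
          (fun k => reg.Zm k / Real.log (1 / reg.a k ^ 2) ^
            Literature.MathematicalPhysics.QuantumFieldTheory.massExponent Nf) ∘ φ := by
        funext k; simp [ha, hZm]
      rw [hfun]
      exact ht.comp hφ.tendsto_atTop
    refine ⟨reg₁, hms₁, hchi₁, fun m hm => ?_⟩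
    obtain ⟨hbr, Δ, hΔ, hgap⟩ := H m hm
    obtain ⟨h2g, h2q, h3g, hconv⟩ := H₁ m hm
    -- (ii) two-loop asymptotic scaling rides along (reads `β`, `a` only)
    have has₁ : (𝒞.scheme m).HasAsymptoticScaling := by
      obtain ⟨Λ, hΛ, ht⟩ := has
      refine ⟨Λ, hΛ, ?_⟩
      have hfun : (fun k => (𝒞.scheme m).β k -
          Literature.MathematicalPhysics.QuantumFieldTheory.afBeta Nf Λ ((𝒞.scheme m).a k)) =
          (fun k => (reg.scheme 0 0 0).β k -
            Literature.MathematicalPhysics.QuantumFieldTheory.afBeta Nf Λ ((reg.scheme 0 0 0).a k)) ∘ φ := by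
        funext k
        simp [Literature.MathematicalPhysics.QuantumFieldTheory.QCDRegularisation.scheme,
          Literature.MathematicalPhysics.QuantumFieldTheory.CalibratedSpeciesFamily.scheme, ha, hβ]
      rw [hfun]
      exact ht.comp hφ.tendsto_atTop
    -- (iii) the physical branch rides along (reads `m_crit`, `a`, `Z_m`)
    have hbr₁ : ∀ fl : Fin Nf, ∀ᶠ k in Filter.atTop, -1 < (𝒞.scheme m).mq fl k := by
      intro fl
      refine (hφ.tendsto_atTop.eventually (hbr fl)).mono fun k hk => ?_
      simpa [ha, hmc, hZm] using hk
    -- (iv) the uniform lattice gap rides along and survives the volume ENLARGEMENT (all tori `S ≥ L_k` are quantified)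
    have hgap₁ : (𝒞.scheme m).HasLatticeMassGap Δ := by
      intro R R' A B
      obtain ⟨C, hC⟩ := hgap R R' A B
      refine ⟨C, (hφ.tendsto_atTop.eventually hC).mono fun k hk S hS n hn => ?_⟩
      have hS' : (reg.scheme m 0 0).L (φ k) ≤ S :=
        (hL k).trans (by simpa [Literature.MathematicalPhysics.QuantumFieldTheory.CalibratedSpeciesFamily.scheme,
          Literature.MathematicalPhysics.QuantumFieldTheory.QCDRegularisation.scheme] using hS)
      simpa [Literature.MathematicalPhysics.QuantumFieldTheory.QCDRegularisation.scheme,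
        Literature.MathematicalPhysics.QuantumFieldTheory.CalibratedSpeciesFamily.scheme, ha, hβ, hmc, hZm]
        using hk S hS' n hn
    -- OS closure of the convergent calibrated family (piece 2), rotations (piece 3), packaging
    obtain ⟨S, -, -, -, -, -, -, -, hConvS, ⟨Δ', hΔ', hGapS, hGapL⟩, hPack⟩ :=
      h₂ Nf reg₁ 𝒞 m hm has₁ hbr₁ ⟨Δ, hΔ, hgap₁⟩ h2g h2q h3g hconv
    have hE1 := h₃ Nf (𝒞.scheme m) has₁ hbr₁ ⟨Δ', hΔ', hGapL⟩ S hConvS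
    obtain ⟨T, hTS, hNT, hNG, hND⟩ := hPack hE1
    subst hTS
    exact ⟨𝒞.z m, 𝒞.shift m, T, ⟨has₁, hbr₁, hConvS⟩, hNT, hNG, hND, Δ', hΔ', hGapS, hGapL⟩
  exact ⟨key 2 (Or.inl rfl), key 3 (Or.inr rfl)⟩


/-- The crux along this skeleton, from the registered stubs (sorries only inside the three `stub_*`). -/
theorem chiralContinuumComplement_of_stubs : ChiralContinuumComplement :=
  ChiralContinuumComplement_of stub_chiralCalibratedConvergence stub_convergentOSClosure stub_rotationRestoration

/-- Shape record: the composition concludes the crux BY NAME (type literally the route decl). -/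
example : ChiralCalibratedConvergence → ConvergentOSClosure → RotationRestoration →
    Summit.QuantumFields.QCD.Theses.CounterexampleMustBeHot.ChiralContinuumComplement :=
  ChiralContinuumComplement_of

end Summit.QuantumFields.QCD.Cruxes.ChiralContinuumComplement.Pieces

end
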